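/-
Origin: expansion seat `planner-pub-hodgecm-pv13-g6-0`, handover #3 2026-08-18T15:05Z (md5 e637d10cd4c45d475f57d18971446458, 176 l.; NEW additive leaf; ONE import rewrite `import Pv13g6.GenuineSchrodingerHeisAdmissible` ↦ `import HodgeCM.PerL34.GenuineSchrodingerHeisAdmissible` (row #2 91f8ed5c); land AFTER row #2; HOLD iff row #1/#2 held) (`HOME/pub-hodgecm-pv13-g6/lean/Pv13g6/GenuineSchrodingerHeisFixedDim.lean`, md5 e637d10c, 176 lines);
landed by the gen-8 packager in gate run 31 as `HodgeCM/PerL34/GenuineSchrodingerHeisFixedDim.lean` (import ^import Pv13g6\.GenuineSchrodingerHeisAdmissible[ \t]*$→import HodgeCM.PerL34.GenuineSchrodingerHeisAdmissible ×1).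
-/
/-
Copyright (c) 2026. All rights reserved.
Released under Apache 2.0 license as described in the file LICENSE.
Authors: unit pub-hodgecm-pv13-g6 (DAG-NODE PROVER #13 gen 6, seam S3, 𝓕-side).

# HodgeCM/PerL34/GenuineSchrodingerHeisFixedDim.lean — the DIMENSION FORMULA
# `dim_ℂ L²(X)^{B_k × B_k} = [B_k^⊥ : B_k]` for the adelic Heisenberg–Schrödinger representation
-/
import Summits.HodgeConjecture.HodgeCM.PerL34.GenuineSchrodingerHeisAdmissible

/-!
# The dimension of the level-`k` fixed spaces of the adelic Heisenberg–Schrödinger representation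

Sequel of `GenuineSchrodingerHeisAdmissible` (this seat's #2; notation as there: `X = ∏'_v (L⁺_v)³`,
`B_k = levelBall L k`, `B_k^⊥ = dualBall ψ hψc hψO k`, `heisFixed ψ hψc hψO k = L²(X)^{B_k × B_k}`,
`cosetInd x k = 1_{x + B_k}`).

* The DIMENSION FORMULA **`finrank_heisFixed`**: for `B_k ⊆ B_k^⊥` compact,
  `dim_ℂ L²(X)^{B_k × B_k} = [B_k^⊥ : B_k]` — the indicators attached to the classes of
  `LevelQuot = B_k^⊥ / B_k` (`quotInd`, through chosen representatives) are linearly independent (pairwise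
  orthogonal, non-zero) and span the fixed space, so they form a basis; in passing `B_k` has finite index in
  `B_k^⊥` (`finite_levelQuot`, `finiteIndex_levelBall_dualBall`, read off the finite-dimensional fixed space)
  and the fixed space is non-zero; `exists_level_finrank_heisFixed` packages the order-`0` case: for all
  `k ≥ k₀`, `[B_k^⊥ : B_k] < ∞` and `dim L²(X)^{B_k × B_k} = [B_k^⊥ : B_k]`.

ABSOLUTE RULE.  Nothing is cited and nothing is posited: every statement is kernel-proved here from this
seat's #1–#2 and Mathlib; hypotheses are caller DATA only (`ψ hψc hψO`; compactness of `B_k^⊥` and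
`B_k ⊆ B_k^⊥` where stated, both automatic for order-`0` data and `k ≥ k₀`).  No PerL / QW8 / 2001-programme
statement appears.  Orientation in print (not used as input): MVW, LNM 1291, ch. 2, I.3 (fixed vectors of a
lattice in the Schrödinger model = functions on the finite group `A^⊥/A`); Weil 1964 no. 13.

Namespace `HodgeCM.PerL34.PureTensor.SchrodingerModel.Coeff`, section `Characters` (binders `ψ hψc hψO` of #1,
`hψO` included).  WIP import `Pv13g6.GenuineSchrodingerHeisAdmissible` ↦
`HodgeCM.PerL34.GenuineSchrodingerHeisAdmissible` (this seat's #2, RUN 31).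
-/

set_option autoImplicit false

noncomputable section

open MeasureTheory MeasureTheory.Measure Set Metric Function Complex Topology Filter
open scoped RestrictedProduct InnerProductSpace NNReal ENNReal Pointwise

namespace HodgeCM.PerL34.PureTensor.SchrodingerModel

open HodgeCM.PerL34.LocalFactors HodgeCM.PerL34.LocalFactors.DilationModel
open HodgeCM.PerL34.LocalFactors.SchrodingerLevi HodgeCM.PerL34.LocalFactors.SchrodingerIrreducible
open HodgeCM.PerL34.IdelePlaces HodgeCM.PerL34.IdelicTorusModel HodgeCM.PerL34.IdelicTorusModel.Genuine
open NumberField IsDedekindDomain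

attribute [local instance] LocalFactors.DilationModel.Adic.nontriviallyNormedField
  LocalFactors.DilationModel.Adic.properSpace

variable {L : Type} [Field L] [NumberField L] [IsCMField L]

namespace Coeff

section Characters

variable (ψ : ∀ i : SplitIdx L, AddChar ((basePlaceOf L i.1).adicCompletion (maximalRealSubfield L)) Circle)
variable (hψc : ∀ i, Continuous (ψ i))
variable (hψO : ∀ᶠ i : SplitIdx L in cofinite,
  ∀ t : (basePlaceOf L i.1).adicCompletion (maximalRealSubfield L), ‖t‖ ≤ 1 → ψ i t = 1)
include hψO

/-! ## The level quotient `B_k^⊥ / B_k` and the basis of class indicators -/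

/-- the level quotient `B_k^⊥ / B_k` (for `B_k ⊆ B_k^⊥` read through `addSubgroupOf`) -/
abbrev LevelQuot (k : ℕ) : Type :=
  dualBall ψ hψc hψO k ⧸ (levelBall L k).addSubgroupOf (dualBall ψ hψc hψO k)

/-- the coset indicator attached to a class of `B_k^⊥ / B_k` (through a chosen representative) -/
def quotInd (k : ℕ) (q : LevelQuot ψ hψc hψO k) : Lp ℂ 2 (μ L) :=
  cosetInd (q.out : dualBall ψ hψc hψO k).1 k

/-- the indicator of the coset of `x ∈ B_k^⊥` is the indicator attached to its class in `B_k^⊥ / B_k` -/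
theorem cosetInd_eq_quotInd {k : ℕ} (x : dualBall ψ hψc hψO k) :
    cosetInd (x : Space L) k = quotInd ψ hψc hψO k (x : LevelQuot ψ hψc hψO k) := by
  obtain ⟨b, hb⟩ := QuotientAddGroup.mk_out_eq_mul ((levelBall L k).addSubgroupOf (dualBall ψ hψc hψO k)) x
  unfold quotInd
  rw [hb]
  refine cosetInd_congr (ballCoset_eq_ballCoset_of_mem_of_mem (mem_ballCoset_self _ k) ?_).symm
  refine mem_ballCoset_iff_sub_mem.2 ?_
  have hb' : ((b : dualBall ψ hψc hψO k) : Space L) ∈ levelBall L k := AddSubgroup.mem_addSubgroupOf.1 b.2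
  simpa using (levelBall L k).neg_mem hb'

/-- the class indicators are fixed vectors (`B_k ⊆ B_k^⊥`) -/
theorem quotInd_mem_heisFixed {k : ℕ}
    (hk : (levelBall L k : Set (Space L)) ⊆ (dualBall ψ hψc hψO k : Set (Space L)))
    (q : LevelQuot ψ hψc hψO k) : quotInd ψ hψc hψO k q ∈ heisFixed ψ hψc hψO k :=
  cosetInd_mem_heisFixed ψ hψc hψO hk (q.out : dualBall ψ hψc hψO k).2

/-- the classes' indicators are linearly independent (pairwise orthogonal, non-zero) -/
theorem linearIndependent_quotInd (k : ℕ) : LinearIndependent ℂ (quotInd ψ hψc hψO k) := by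
  refine linearIndependent_of_ne_zero_of_inner_eq_zero (fun q => cosetInd_ne_zero _ k) fun q q' hqq' => ?_
  refine inner_cosetInd_eq_zero (ballCoset_inter_eq_empty fun hmem => hqq' ?_)
  rw [← Quotient.out_eq q, ← Quotient.out_eq q']
  refine Quotient.sound ?_
  change (QuotientAddGroup.leftRel _) _ _
  rw [QuotientAddGroup.leftRel_apply, AddSubgroup.mem_addSubgroupOf]
  have : -((q.out : dualBall ψ hψc hψO k) : Space L) + ((q'.out : dualBall ψ hψc hψO k) : Space L) ∈
      levelBall L k := by
    rw [neg_add_eq_sub, ← neg_sub]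
    exact (levelBall L k).neg_mem hmem
  simpa using this

/-- the classes' indicators span the fixed space (`B_k ⊆ B_k^⊥` compact) -/
theorem span_range_quotInd {k : ℕ} (hcpt : IsCompact (dualBall ψ hψc hψO k : Set (Space L)))
    (hk : (levelBall L k : Set (Space L)) ⊆ (dualBall ψ hψc hψO k : Set (Space L))) :
    Submodule.span ℂ (Set.range (quotInd ψ hψc hψO k)) = heisFixed ψ hψc hψO k := by
  refine le_antisymm (Submodule.span_le.2 ?_) ?_
  · rintro _ ⟨q, rfl⟩
    exact quotInd_mem_heisFixed ψ hψc hψO hk q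
  · rw [heisFixed_eq_cosetSpan_dualBall ψ hψc hψO hcpt hk]
    refine Submodule.span_le.2 ?_
    rintro _ ⟨x, hx, rfl⟩
    change cosetInd ((⟨x, hx⟩ : dualBall ψ hψc hψO k) : Space L) k ∈ _
    rw [cosetInd_eq_quotInd ψ hψc hψO ⟨x, hx⟩]
    exact Submodule.subset_span ⟨_, rfl⟩

/-- `B_k` has finite index in a compact `B_k^⊥ ⊇ B_k` (read off the finite-dimensional fixed space) -/
theorem finite_levelQuot {k : ℕ} (hcpt : IsCompact (dualBall ψ hψc hψO k : Set (Space L)))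
    (hk : (levelBall L k : Set (Space L)) ⊆ (dualBall ψ hψc hψO k : Set (Space L))) :
    Finite (LevelQuot ψ hψc hψO k) := by
  haveI := finiteDimensional_heisFixed ψ hψc hψO hcpt
  let e : LevelQuot ψ hψc hψO k → heisFixed ψ hψc hψO k := fun q =>
    ⟨quotInd ψ hψc hψO k q, quotInd_mem_heisFixed ψ hψc hψO hk q⟩
  have he : LinearIndependent ℂ e :=
    LinearIndependent.of_comp (heisFixed ψ hψc hψO k).subtype (linearIndependent_quotInd ψ hψc hψO k)
  exact he.finite_of_isNoetherian

/-- **THE DIMENSION FORMULA**: for `B_k ⊆ B_k^⊥` compact,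
`dim_ℂ L²(X)^{B_k × B_k} = [B_k^⊥ : B_k]` (the index of `B_k` in the dual ball). -/
theorem finrank_heisFixed {k : ℕ} (hcpt : IsCompact (dualBall ψ hψc hψO k : Set (Space L)))
    (hk : (levelBall L k : Set (Space L)) ⊆ (dualBall ψ hψc hψO k : Set (Space L))) :
    Module.finrank ℂ (heisFixed ψ hψc hψO k) =
      ((levelBall L k).addSubgroupOf (dualBall ψ hψc hψO k)).index := by
  haveI := finite_levelQuot ψ hψc hψO hcpt hk
  letI : Fintype (LevelQuot ψ hψc hψO k) := Fintype.ofFinite _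
  rw [AddSubgroup.index, Nat.card_eq_fintype_card,
    ← finrank_span_eq_card (linearIndependent_quotInd ψ hψc hψO k)]
  exact (LinearEquiv.ofEq _ _ (span_range_quotInd ψ hψc hψO hcpt hk).symm).finrank_eq

/-- in particular the index `[B_k^⊥ : B_k]` is finite and the fixed space is non-zero -/
theorem finiteIndex_levelBall_dualBall {k : ℕ} (hcpt : IsCompact (dualBall ψ hψc hψO k : Set (Space L)))
    (hk : (levelBall L k : Set (Space L)) ⊆ (dualBall ψ hψc hψO k : Set (Space L))) :
    ((levelBall L k).addSubgroupOf (dualBall ψ hψc hψO k)).FiniteIndex := by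
  haveI := finite_levelQuot ψ hψc hψO hcpt hk
  exact AddSubgroup.finiteIndex_of_finite_quotient

/-- the fixed space is non-zero for `B_k ⊆ B_k^⊥` compact -/
theorem finrank_heisFixed_pos {k : ℕ} (hcpt : IsCompact (dualBall ψ hψc hψO k : Set (Space L)))
    (hk : (levelBall L k : Set (Space L)) ⊆ (dualBall ψ hψc hψO k : Set (Space L))) :
    0 < Module.finrank ℂ (heisFixed ψ hψc hψO k) := by
  rw [finrank_heisFixed ψ hψc hψO hcpt hk]
  haveI := finiteIndex_levelBall_dualBall ψ hψc hψO hcpt hk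
  exact AddSubgroup.FiniteIndex.index_ne_zero.bot_lt

/-- **order-`0` data**: for every `k ≥ k₀` the fixed space `L²(X)^{B_k × B_k}` has dimension exactly
`[B_k^⊥ : B_k]`, a finite positive integer. -/
theorem exists_level_finrank_heisFixed (hψ : ∀ i, ∃ t, ψ i t ≠ 1)
    (hψ1 : ∀ᶠ i : SplitIdx L in cofinite, ∀ t, ψ i t = 1 → ‖t‖ ≤ 1) :
    ∃ k₀, ∀ k, k₀ ≤ k →
      ((levelBall L k).addSubgroupOf (dualBall ψ hψc hψO k)).FiniteIndex ∧
      Module.finrank ℂ (heisFixed ψ hψc hψO k) =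
        ((levelBall L k).addSubgroupOf (dualBall ψ hψc hψO k)).index := by
  obtain ⟨k₀, hk₀⟩ := exists_level_levelBall_subset_dualBall ψ hψc hψO
  exact ⟨k₀, fun k hk =>
    ⟨finiteIndex_levelBall_dualBall ψ hψc hψO (isCompact_dualBall ψ hψc hψO hψ hψ1 k) (hk₀ k hk),
      finrank_heisFixed ψ hψc hψO (isCompact_dualBall ψ hψc hψO hψ hψ1 k) (hk₀ k hk)⟩⟩

end Characters

end Coeff

end HodgeCM.PerL34.PureTensor.SchrodingerModel
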